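import Summits.HubbardSuperconductivity.HubbardSuperconductivity.Theses.NodalDiracTwist
import Summits.HubbardSuperconductivity.HubbardSuperconductivity.Theses.AposterioriCapRg
import Summits.HubbardSuperconductivity.HubbardSuperconductivity.Theorems.NodalDiracTwistBridgeNodalToDWaveNDSpeaksFrequently
import Summits.HubbardSuperconductivity.HubbardSuperconductivity.Theorems.NodalDiracTwistBridgeNodalToDWaveUniqueGroundState
import Summits.HubbardSuperconductivity.HubbardSuperconductivity.Theorems.NodalDiracTwistBridgeNodalToDWaveSubsequenceOrderForcesSSB
import Summits.HubbardSuperconductivity.HubbardSuperconductivity.Theorems.NodalDiracTwistBridgeNodalToDWaveEnergyMatching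
import Summits.HubbardSuperconductivity.HubbardSuperconductivity.Theorems.NodalDiracTwistBridgeNodalToDWaveSourcedEnergyDensityLimit
import Summits.HubbardSuperconductivity.HubbardSuperconductivity.Theorems.WeakCouplingBCSWcbcsBcsConstructionEnergyDensityLimit
import Summits.HubbardSuperconductivity.HubbardSuperconductivity.Theorems.NodalDiracTwistBridgeNodalToDWaveOfClassificationCore
import Literature.MathematicalPhysics.QuantumLattice.HubbardGrandCanonicalDensity
import Literature.MathematicalPhysics.QuantumLattice.SpinTwistedHubbardTorus
import Literature.MathematicalPhysics.QuantumLattice.DWaveSource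
import Literature.MathematicalPhysics.QuantumLattice.PairCorrelationsProofs
import Literature.MathematicalPhysics.QuantumLattice.LatticeToriLROProofs
import Summits.HubbardSuperconductivity.HubbardSuperconductivity.Theorems.NodalDiracTwistBridgeNodalToDWaveRealMomentumDiagonal
import Summits.HubbardSuperconductivity.HubbardSuperconductivity.Theorems.NodalDiracTwistBridgeNodalToDWaveDiracIntraBlockMomentum
import Summits.HubbardSuperconductivity.HubbardSuperconductivity.Theorems.NodalDiracTwistBridgeNodalToDWaveDiagonalParitySegment

/-!
# Skeleton for crux `BridgeNodalToDWave` — stmt-HubbardSuperconductivity-10395, line `birth`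
(route `NodalDiracTwist`, rank 4; sub-problem `HubbardSuperconductivity`) — lead c12, skeleton v10

Lead `prover-line-stmt-HubbardSuperconductivity-10395-c11-0`, 2026-08-17, continuing the birth
skeleton of `planner-skel-stmt-HubbardSuperconductivity-10395-0` (`Cruxes/BridgeNodalToDWave/Lines/birth.lean`)
as reshaped by leads c1–c7 (v5, sha 6e823d63d553) and c10 (v6).

v10 (c12) = v9 with stub D3c RESHAPED to the weaker form the composition actually consumes:
`stub_densityMatchedWindow` (D3c': for all small `U` and every `δ ∈ [1/10,3/10]` a density-matched `μ` —
no grand-canonical density jump across `[7/10,9/10]`; plateaus allowed), implied by the former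
`stub_regularEquationOfStateIcc` (`densityMatchedWindow_of_regularEOS`); `BridgeNodalToDWave_of hC hDMW h1315`
re-proved inline (the p147723 proof with `μ` taken from D3c'); `BridgeNodalToDWave_of_regularEOS` keeps the
old route.  Registered stubs: C `stub_classificationCore`, D3c' `stub_densityMatchedWindow`.
v9 (c12) = v8 + the registered structural sub-goal `stub_diagonalParityFlip` (the diagonal parity flip:
holonomy `−1` at a diagonal Dirac point forces opposite swap-parity of the unique sector ground states on
the two sides — a new kernel-checked necessary condition of the package, see its section below).
v8 (c11) = v7 + the section "Structural sub-goals (CLOSED, lead c11)" below, which records the nine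
kernel-checked structural consequences of the nodal-Dirac package landed by c11 (--supports; they are
inputs any proof of C may use for free, and necessary conditions a disprover of ND can test).
v7 (c11) = v5 with the two compositions now ONE-LINE applications of the tree theorems landed by c10
(p147723, `Theorems/NodalDiracTwistBridgeNodalToDWaveOfClassificationCore.lean`:
`nodalOrderAlongSubsequence_of_classificationCore`, `bridgeNodalToDWave_of_classificationCore`); the
registered stub set is unchanged (`stub_classificationCore` = C, lead-held, crux-sized per c8/c9/c10/c11;
`stub_regularEquationOfStateIcc` = D3c, blocked on the open `T = 0` equation-of-state regularity shared with
stmt-2010 / stmt-1315); `SsbToEvenTorusLro` (stmt-1315) remains the named hypothesis `h1315`.  No delegable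
stub ⇒ wave: none.  The v5 text below is kept verbatim apart from this header and the two proof terms.

The crux: `BridgeNodalToDWave := ∃ U₀ > 0, ∀ U ∈ (0,U₀), ∀ δ ∈ [1/10,3/10], ND(U,δ) → LRO(U,δ)`, where
`ND(U,δ)` is the route's nodal-Dirac package (node momentum `κ`, `cos κ ≠ 0`; for every `ε > 0`, on all
large EVEN sides `L` with `dist(Lκ, πℤ) ≥ ε`, the `(N_L, S^z = 0)`-sector ground state of the
spin-twisted torus `H_L(U,φ)` (`= spinTwistedHubbardTorus L U φ` by `rfl`) is degenerate at exactly
the diagonal quartet `(±c_L, ±c_L)` of `(−π,π]²`, `|cos c_L − cos Lκ| ≤ ε`, with cyclic-overlap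
holonomy `−1` around each) and `LRO(U,δ)` is the Statement's conclusion verbatim (every normalised
`(N_L,0)`-sector ground-state sequence `ψ` of `hubbardTorus 2 L 1 U` has `0 < liminf_k F_ψ(k)`,
`F_ψ(k) := |Λ_{2k}|⁻² Σ_{x,y ∈ Λ_{2k}} G_{2k}(x,y)`, `G = pairFieldCorr dWaveFormFactor ψ`).

THE LINE (birth) = "classify where `ND` speaks, then absorb the resonant (silent) sides".

RESHAPE v3/v4/v5 (lead c7, after waves 1–2; wave 2 LANDED D1 p142988, D3b p143074, D3a p143420). Wave 1: stubs A and B LANDED (p141870, p141864); stub D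
(`SubsequenceRigidity`: frequent order ⇒ eventual order, "Koma–Tasaki engine") came back
`stub-misstated`: only its forward leg (order along a subsequence ⇒ Koma–Tasaki `d`-wave order
`HasDWaveOrder U μ` under a pair source, thermodynamic limit first) is a theorem (KomaTasaki1994
Thm 2.3 / Remark 2); its return leg (Koma–Tasaki order ⇒ pair LRO of EVERY sector ground state at
EVERY large even side) is Koma–Tasaki's own open Conjecture 10 + `μ₁ = μ₂` and is, BY NAME, the tree's
open transfer crux `Theses.AposterioriCapRg.SsbToEvenTorusLro` (stmt-HubbardSuperconductivity-1315;
twins stmt-2009 `WcbcsSsbToTorusLRO`, stmt-10439). The honest skeleton therefore routes the silent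
sides through that crux, taken as a NAMED HYPOTHESIS of the composition (nothing is restated):

* A `stub_ndSpeaksFrequently` — CLOSED (`Theorems/NodalDiracTwistBridgeNodalToDWaveNDSpeaksFrequently.lean`).
* B `stub_uniqueGroundStateOfPackage` — CLOSED (`Theorems/NodalDiracTwistBridgeNodalToDWaveUniqueGroundState.lean`).
* C `stub_classificationCore` (THE PHYSICS, XL, lead): per-volume classification, constants uniform in
  the side: Dirac quartet with holonomy `−1` for `H_L(U,·)` + unique untwisted sector GS ⇒
  `c₀ L⁴ ≤ re⟨χ, Δ_d†Δ_d χ⟩` for every normalised sector GS `χ` of `hubbardTorus 2 L 1 U`.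
* D1 `stub_subsequenceOrderForcesSSB` — CLOSED (p142988; Koma–Tasaki forward leg): at fixed `(U, δ, μ)`, given (TL) the thermodynamic limit of the sourced grand-canonical
  ground-energy density `E₀(dWaveSourceTorus L U μ h)/L²` for every `h ≥ 0` and (EM) energy matching
  of the `(N_L,0)` sector with the grand-canonical ground energy at `μ`
  (`(minEnergyOn − μN_L − E₀^{GC})/L² → 0`), an admissible family with `F_ψ(k) ≥ c > 0` frequently
  forces `HasDWaveOrder U μ`.  Proof route (KT-lite, no towers): at an ordered side, `Φ = ψ_L`,
  `O = Δ_d + Δ_d†`, trial state `(Φ + OΦ/‖OΦ‖)/√2`: `⟨Φ,OΦ⟩ = ⟨Φ,O³Φ⟩ = 0` (particle number),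
  `‖OΦ‖² ≥ re⟨Φ,Δ_d†Δ_dΦ⟩ ≥ cL⁴`, `⟨OΦ,(H−E)OΦ⟩ = ½⟨Φ,[O,[H,O]]Φ⟩ ≤ C L²`
  (`Theorems/AposterioriCapRgSsbToEvenTorusLroDoubleCommBound.stub_doubleCommBound`, `pairFieldAt_zero`),
  so `E₀(L,h) ≤ E_Φ + C/(4cL²) − h√c L²`; with (EM), (TL): `liminf_L [E₀(L,0)−E₀(L,h)]/(2hL²) ≥ √c/2`
  for every small `h`, and `le_dWaveOrderParameter_of_le_liminf_energyGain` concludes.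
* D3a `stub_sourcedEnergyDensityLimit` — CLOSED (p143420; zero-temperature sandwich of the sourced pressure limit).
* D3b `stub_energyMatchingOfDensityMatching` — CLOSED (p143074): (DM) the grand-canonical tracial
  ground-state density at `μ` tends to `1 − δ` (the hypothesis of stmt-1315) ⇒ (EM) (Legendre duality of
  the convex canonical energy density `convexOn_energyDensity2D` with the uniform tiling bound
  `energyDensity2D_le`; minimisers of `e(n) − μn` form an interval containing `1 − δ`; `S^z = 0` costs
  nothing for even `N` by `SU(2)`).
* D3c' `stub_densityMatchedWindow` (OPEN; v10, lead c12): for small `U` and every `δ ∈ [1/10,3/10]` a `μ` with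
  grand-canonical density → `1 − δ` (verbatim the hypothesis of stmt-1315) — the weakest EOS input the
  composition needs (no density jump across `[7/10,9/10]`); implied by the former
* D3c `stub_regularEquationOfStateIcc` (no longer registered; sufficient for D3c'): for small `U` the `T = 0`
  grand-canonical equation of state is differentiable on a `μ`-window bracketing densities `[7/10, 9/10]`
  (no phase separation there); `densityMatched_of_regularEOS` turns it into `∀ δ ∈ [1/10,3/10] ∃ μ` with
  (DM). Shared open input with crux stmt-2010's `stub_regularEquationOfState`.
* stmt-1315 `SsbToEvenTorusLro` — named hypothesis `h1315` of `BridgeNodalToDWave_of` (open crux of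
  route AposterioriCapRg; its conclusion is the Statement's LRO for EVERY admissible family).
* Compositions (no `sorry`): `nodalOrderAlongSubsequence_of_core : C → NodalOrderAlongSubsequence` (A, B used as
  landed theorems);
  `BridgeNodalToDWave_of : C → D3c' → SsbToEvenTorusLro → BridgeNodalToDWave` (A, B, D1, D3a, D3b enter as the
  landed theorems; `BridgeNodalToDWave_of_regularEOS : C → D3c → … ` = tree p147723).

Disproof used: none exists for this crux (`ledger crux ls`, 2026-08-17T04:40Z). Refuter crux attack
2026-08-15 (SURVIVES) honoured: `ND` is consumed (A+B+C); the resonant-progression gap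
(`nd_premise_silent_on_progression`) is carried by D1+D3a/b/c+stmt-1315 — and is thereby shown to be the
SAME open transfer problem every Koma–Tasaki-based route of this summit faces.
-/

-- `Summit.<Summit>.<Problem>`: for the single-conjunct summit the duplicate namespace is mandated.
set_option linter.dupNamespace false
set_option linter.unusedVariables false

noncomputable section

namespace Summit.HubbardSuperconductivity.HubbardSuperconductivity.Cruxes.BridgeNodalToDWave.Birth

open Filter Finset Matrix
open Literature.Probability.LatticeModels Literature.MathematicalPhysics.QuantumLattice
open Summit.HubbardSuperconductivity.HubbardSuperconductivity.Theses.NodalDiracTwist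
open scoped ComplexOrder

/-! ## Birth-level statement (composition target of A+B+C) -/

/-- **Birth stub 1 statement (now derived from A+B+C): nodal Dirac quartet ⇒ `d`-wave pair order
along infinitely many even sides.**  `∃ U₀ > 0 ∀ U ∈ (0,U₀) ∀ δ ∈ [1/10,3/10]`, `ND(U,δ)` (VERBATIM
the hypothesis of `BridgeNodalToDWave`) ⇒ every normalised `(N_L, S^z=0)`-sector ground-state
sequence `ψ` of `hubbardTorus 2 L 1 U` has `F_ψ(k) ≥ c` for some `c > 0` and infinitely many `k`.
Scalapino, Phys. Rep. 250 (1995) 329, §2 eq. (2.4); ArovasBergKivelsonRaghu2022 §5.1. [folklore] -/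
def NodalOrderAlongSubsequence : Prop :=
  ∃ U₀ : ℝ, 0 < U₀ ∧ ∀ U ∈ Set.Ioo (0 : ℝ) U₀, ∀ δ ∈ Set.Icc (1 / 10 : ℝ) (3 / 10),
    (∃ κ : ℝ, 0 < κ ∧ κ < Real.pi ∧ Real.cos κ ≠ 0 ∧ ∀ ε : ℝ, 0 < ε → ∃ L₀ : ℕ, ∀ (L : ℕ) [NeZero
    L], Even L → L₀ ≤ L → (∀ m : ℤ, ε ≤ |L * κ - m * Real.pi|) →
      let sh : Literature.MathematicalPhysics.QuantumLattice.FermionTorus 2 L → Fin 2 → Literature.MathematicalPhysics.QuantumLattice.FermionTorus 2 L := fun x μ => toLex (Function.update (ofLex x) μ (ofLex x μ + 1));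
      let a := fun (x : Literature.MathematicalPhysics.QuantumLattice.FermionTorus 2 L) (σ : Fin 2) => Literature.MathematicalPhysics.QuantumLattice.annihilation (Literature.MathematicalPhysics.QuantumLattice.orb x σ);
      let H := fun φ : Fin 2 → ℝ => -(∑ x : Literature.MathematicalPhysics.QuantumLattice.FermionTorus 2 L, ∑ μ : Fin 2, ∑ σ : Fin 2, (Complex.exp (Complex.I * (((-1 : ℝ) ^ (σ : ℕ) * φ μ / L : ℝ) : ℂ)) • (Matrix.conjTranspose (a x σ) * a (sh x μ) σ) + Complex.exp (-(Complex.I * (((-1 : ℝ) ^ (σ : ℕ) * φ μ / L : ℝ) : ℂ))) • (Matrix.conjTranspose (a (sh x μ) σ) * a x σ))) + (U : ℂ) • ∑ x : Literature.MathematicalPhysics.QuantumLattice.FermionTorus 2 L, Literature.MathematicalPhysics.QuantumLattice.numberOp x 0 * Literature.MathematicalPhysics.QuantumLattice.numberOp x 1;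
      ∃ c : ℝ, 0 < c ∧ c < Real.pi ∧ |Real.cos c - Real.cos (L * κ)| ≤ ε ∧ (∀ φ : Fin 2 → ℝ, φ 0 ∈
      Set.Ioc (-Real.pi) Real.pi → φ 1 ∈ Set.Ioc (-Real.pi) Real.pi → ((∃ ψ₁ ψ₂,
      Literature.MathematicalPhysics.QuantumLattice.IsGroundStateInSector (H φ) (2 * ⌊(1 - δ) * (L :
      ℝ) ^ 2 / 2⌋₊) 0 ψ₁ ∧ Literature.MathematicalPhysics.QuantumLattice.IsGroundStateInSector (H φ)
      (2 * ⌊(1 - δ) * (L : ℝ) ^ 2 / 2⌋₊) 0 ψ₂ ∧ star ψ₁ ⬝ᵥ ψ₂ = 0) ↔ (|φ 0| = c ∧ |φ 1| = c))) ∧ (∀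
      p : Fin 2 → ℝ, |p 0| = c → |p 1| = c → ∀ r : ℝ, 0 < r → r < min c (Real.pi - c) → ∃ n₀ : ℕ, ∀
      n ≥ n₀, ∀ ψ : Fin n → (Finset (Literature.MathematicalPhysics.QuantumLattice.Orb
      (Literature.MathematicalPhysics.QuantumLattice.FermionTorus 2 L)) → ℂ), (∀ i : Fin n,
      Literature.MathematicalPhysics.QuantumLattice.IsGroundStateInSector (H (fun ν : Fin 2 => p ν +
      r * (if ν = 0 then Real.cos (2 * Real.pi * (i : ℕ) / n) else Real.sin (2 * Real.pi * (i : ℕ) /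
      n)))) (2 * ⌊(1 - δ) * (L : ℝ) ^ 2 / 2⌋₊) 0 (ψ i) ∧ star (ψ i) ⬝ᵥ ψ i = 1) → (∏ i : Fin n, star
      (ψ i) ⬝ᵥ ψ (finRotate n i)).re < 0)) →
    ∀ (N : ℕ → ℕ) (ψ : ∀ L, Literature.MathematicalPhysics.QuantumLattice.Fock
    (Literature.MathematicalPhysics.QuantumLattice.Orb
    (Literature.MathematicalPhysics.QuantumLattice.FermionTorus 2 L))), (∀ L, Even L → N L = 2 * ⌊(1
    - δ) * (L : ℝ) ^ 2 / 2⌋₊ ∧ star (ψ L) ⬝ᵥ ψ L = 1 ∧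
    Literature.MathematicalPhysics.QuantumLattice.IsGroundStateInSector
    (Literature.MathematicalPhysics.QuantumLattice.hubbardTorus 2 L 1 U) (N L) 0 (ψ L)) →
    ∃ c : ℝ, 0 < c ∧ ∃ᶠ k : ℕ in Filter.atTop, c ≤ (∑ x ∈
    Literature.Probability.LatticeModels.halfOpenBox 2 (2 * k), ∑ y ∈
    Literature.Probability.LatticeModels.halfOpenBox 2 (2 * k),
    Literature.MathematicalPhysics.QuantumLattice.torusPullback
    (Literature.MathematicalPhysics.QuantumLattice.pairFieldCorr
    Literature.MathematicalPhysics.QuantumLattice.dWaveFormFactor ψ) (2 * k) x y) /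
    ((Literature.Probability.LatticeModels.halfOpenBox 2 (2 * k)).card : ℝ) ^ 2

/-- **Stub C statement (the classification core, per volume, constants uniform in the side): diagonal
Dirac quartet with holonomy `−1` + unique untwisted ground state ⇒ `d_{x²−y²}` pair-order floor.**
There is `U₀ > 0` such that for `0 < U < U₀`, `δ ∈ [1/10,3/10]` there are `c₀ > 0` and `L₁` with: at
every even side `L ≥ L₁` at which (i) for some `c ∈ (0,π)` the `(N_L,0)`-sector ground state of
`H_L(U,φ) = spinTwistedHubbardTorus L U φ` is degenerate at EXACTLY the four twists `(±c,±c)` of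
`(−π,π]²` and the cyclic overlap product of unit ground states around each of them is eventually
negative (holonomy `−1`), and (ii) the `(N_L,0)`-sector ground state of `hubbardTorus 2 L 1 U` is unique
up to scalars, every normalised such ground state `χ` satisfies `c₀ L⁴ ≤ re ⟨χ, Δ_d† Δ_d χ⟩`,
`Δ_d = pairField dWaveFormFactor L`, `N_L = 2⌊(1−δ)L²/2⌋`.  Heuristic content (folklore, no theorem
at any coupling): isolated DIAGONAL Dirac points of the fixed-`N` spectral flow under opposite spin
twists need a point-like zero set of spin-carrying fermionic excitations with `B₁g` node geometry and
no Fermi surface; at weak coupling with translation invariance the only known such state is the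
`d_{x²−y²}` condensate, whose pair amplitude is extensive.  Named competitor: the nodal liquid
(Balents–Fisher–Nayak 1998).  ArovasBergKivelsonRaghu2022 §5.1; RaghuKivelsonScalapino2010 §III;
ScalapinoWhiteZhang1993; Scalapino, Phys. Rep. 250 (1995) 329, §2. [folklore] -/
def ClassificationCore : Prop :=
  ∃ U₀ : ℝ, 0 < U₀ ∧ ∀ U ∈ Set.Ioo (0 : ℝ) U₀, ∀ δ ∈ Set.Icc (1 / 10 : ℝ) (3 / 10),
    ∃ c₀ : ℝ, 0 < c₀ ∧ ∃ L₁ : ℕ, ∀ (L : ℕ) [NeZero L], Even L → L₁ ≤ L →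
    (∃ c : ℝ, 0 < c ∧ c < Real.pi ∧
      (∀ φ : Fin 2 → ℝ, φ 0 ∈ Set.Ioc (-Real.pi) Real.pi → φ 1 ∈ Set.Ioc (-Real.pi) Real.pi →
        ((∃ ψ₁ ψ₂ : Fock (Orb (FermionTorus 2 L)),
          IsGroundStateInSector (spinTwistedHubbardTorus L U φ) (2 * ⌊(1 - δ) * (L : ℝ) ^ 2 / 2⌋₊) 0 ψ₁ ∧
          IsGroundStateInSector (spinTwistedHubbardTorus L U φ) (2 * ⌊(1 - δ) * (L : ℝ) ^ 2 / 2⌋₊) 0 ψ₂ ∧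
          star ψ₁ ⬝ᵥ ψ₂ = 0) ↔ (|φ 0| = c ∧ |φ 1| = c))) ∧
      (∀ p : Fin 2 → ℝ, |p 0| = c → |p 1| = c → ∀ r : ℝ, 0 < r → r < min c (Real.pi - c) →
        ∃ n₀ : ℕ, ∀ n ≥ n₀, ∀ ψ : Fin n → Fock (Orb (FermionTorus 2 L)),
        (∀ i : Fin n, IsGroundStateInSector (spinTwistedHubbardTorus L U (fun ν : Fin 2 => p ν +
          r * (if ν = 0 then Real.cos (2 * Real.pi * (i : ℕ) / n) else Real.sin (2 * Real.pi * (i : ℕ) / n))))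
          (2 * ⌊(1 - δ) * (L : ℝ) ^ 2 / 2⌋₊) 0 (ψ i) ∧ star (ψ i) ⬝ᵥ ψ i = 1) →
        (∏ i : Fin n, star (ψ i) ⬝ᵥ ψ (finRotate n i)).re < 0)) →
    (∀ χ₁ χ₂ : Fock (Orb (FermionTorus 2 L)),
      IsGroundStateInSector (hubbardTorus 2 L 1 U) (2 * ⌊(1 - δ) * (L : ℝ) ^ 2 / 2⌋₊) 0 χ₁ →
      IsGroundStateInSector (hubbardTorus 2 L 1 U) (2 * ⌊(1 - δ) * (L : ℝ) ^ 2 / 2⌋₊) 0 χ₂ →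
      ∃ z : ℂ, χ₂ = z • χ₁) →
    ∀ χ : Fock (Orb (FermionTorus 2 L)),
      IsGroundStateInSector (hubbardTorus 2 L 1 U) (2 * ⌊(1 - δ) * (L : ℝ) ^ 2 / 2⌋₊) 0 χ →
      star χ ⬝ᵥ χ = 1 →
      c₀ * (L : ℝ) ^ 4 ≤ (expect ((pairField dWaveFormFactor L)ᴴ * pairField dWaveFormFactor L) χ).re

/-- **Stub D1 statement (Koma–Tasaki forward leg for the `d`-wave pair field): pair order along a
subsequence of sides forces Koma–Tasaki `d`-wave order.**  At fixed `(U, δ, μ)` with `U > 0`: if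
(TL) the sourced grand-canonical ground-energy density `E₀(dWaveSourceTorus L U μ h)/L²` converges for
every `h ≥ 0`, and (EM) the `(N_L, S^z=0)`-sector ground energy of `hubbardTorus 2 L 1 U` matches the
grand-canonical ground energy at `μ` to `o(L²)`, then every admissible family `ψ` with
`F_ψ(k) ≥ c > 0` for infinitely many `k` gives `HasDWaveOrder U μ` (indeed
`dWaveOrderParameter U μ ≥ √c/2`).  Koma–Tasaki, J. Stat. Phys. 76 (1994) 745, Theorem 2.3 and
Remark 2 after Cor. 2.10 (LRO ⇒ SSB under an infinitesimal field; Kaplan–Horsch–von der Linden 1989);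
here in the weak (linear-energy-gain) form via `le_dWaveOrderParameter_of_le_liminf_energyGain`. [cite: KomaTasaki1994, Theorem 2.3] -/
def SubsequenceOrderForcesSSB : Prop :=
  ∀ (U δ μ : ℝ), 0 < U → δ ∈ Set.Icc (1 / 10 : ℝ) (3 / 10) →
    (∀ h : ℝ, 0 ≤ h → ∃ e : ℝ, Filter.Tendsto (fun L : ℕ =>
      (Literature.MathematicalPhysics.QuantumLattice.dWaveSourceTorus (L + 1) U μ h).groundEnergy /
        ((L + 1 : ℕ) : ℝ) ^ 2) Filter.atTop (nhds e)) →
    Filter.Tendsto (fun L : ℕ =>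
      ((Literature.MathematicalPhysics.QuantumLattice.hubbardTorus 2 (L + 1) 1 U).minEnergyOn
          (Literature.MathematicalPhysics.QuantumLattice.szSector
            (2 * ⌊(1 - δ) * ((L + 1 : ℕ) : ℝ) ^ 2 / 2⌋₊) 0) -
        μ * ((2 * ⌊(1 - δ) * ((L + 1 : ℕ) : ℝ) ^ 2 / 2⌋₊ : ℕ) : ℝ) -
        (Literature.MathematicalPhysics.QuantumLattice.hubbardTorusWith 2 (L + 1) 1 U μ).groundEnergy) /
        ((L + 1 : ℕ) : ℝ) ^ 2) Filter.atTop (nhds 0) →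
    ∀ (N : ℕ → ℕ) (ψ : ∀ L, Literature.MathematicalPhysics.QuantumLattice.Fock
    (Literature.MathematicalPhysics.QuantumLattice.Orb
    (Literature.MathematicalPhysics.QuantumLattice.FermionTorus 2 L))), (∀ L, Even L → N L = 2 * ⌊(1
    - δ) * (L : ℝ) ^ 2 / 2⌋₊ ∧ star (ψ L) ⬝ᵥ ψ L = 1 ∧
    Literature.MathematicalPhysics.QuantumLattice.IsGroundStateInSector
    (Literature.MathematicalPhysics.QuantumLattice.hubbardTorus 2 L 1 U) (N L) 0 (ψ L)) →
    (∃ c : ℝ, 0 < c ∧ ∃ᶠ k : ℕ in Filter.atTop, c ≤ (∑ x ∈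
    Literature.Probability.LatticeModels.halfOpenBox 2 (2 * k), ∑ y ∈
    Literature.Probability.LatticeModels.halfOpenBox 2 (2 * k),
    Literature.MathematicalPhysics.QuantumLattice.torusPullback
    (Literature.MathematicalPhysics.QuantumLattice.pairFieldCorr
    Literature.MathematicalPhysics.QuantumLattice.dWaveFormFactor ψ) (2 * k) x y) /
    ((Literature.Probability.LatticeModels.halfOpenBox 2 (2 * k)).card : ℝ) ^ 2) →
    Literature.MathematicalPhysics.QuantumLattice.HasDWaveOrder U μ

/-- **Stub D3a statement (thermodynamic limit of the sourced grand-canonical ground-energy density).**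
For `U ≥ 0`, every `μ` and every source strength `h ≥ 0`, `E₀(dWaveSourceTorus L U μ h)/L²` converges
as `L → ∞`.  Ruelle, *Statistical Mechanics* (1969) §2.2, §3.3 (Fekete along squares; cf. the tree's
canonical `tendsto_groundEnergyAt_square_div_sq`). [cite: Ruelle1969, §3.3] -/
def SourcedEnergyDensityLimit : Prop :=
  ∀ (U μ h : ℝ), 0 ≤ U → 0 ≤ h → ∃ e : ℝ, Filter.Tendsto (fun L : ℕ =>
      (Literature.MathematicalPhysics.QuantumLattice.dWaveSourceTorus (L + 1) U μ h).groundEnergy /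
        ((L + 1 : ℕ) : ℝ) ^ 2) Filter.atTop (nhds e)

/-- **Stub D3b statement (density matching forces energy matching).**  For `U > 0`,
`δ ∈ [1/10, 3/10]` and any `μ`: if (DM) the grand-canonical tracial ground-state density of
`hubbardTorusWith 2 L 1 U μ` tends to `1 − δ` (verbatim the hypothesis of `SsbToEvenTorusLro`), then (EM)
the `(N_L, S^z = 0)`-sector ground energy of `hubbardTorus 2 L 1 U`, `N_L = 2⌊(1−δ)L²/2⌋`, equals the
grand-canonical ground energy at `μ` plus `μ N_L` up to `o(L²)`.  Mechanism: canonical thermodynamic limit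
`e(n)` (`tendsto_groundEnergyAt_square_div_sq`, convex: `convexOn_energyDensity2D`, uniform tiling lower
bound `energyDensity2D_le`) ⇒ grand-canonical limit `min_n (e(n) − μ n)` (Legendre); the densities charged
by the tracial ground state are asymptotic minimisers, a convex set, so (DM) puts `1 − δ` in the minimiser
interval, where `e(1−δ) − μ(1−δ)` is the minimum; the `S^z = 0` restriction costs nothing for even `N`
(`SU(2)`). Ruelle (1969) §3.4; Lieb, PRL 62 (1989) 1201 (spin sectors). [folklore] -/
def EnergyMatchingOfDensityMatching : Prop :=
  ∀ (U δ μ : ℝ), 0 < U → δ ∈ Set.Icc (1 / 10 : ℝ) (3 / 10) →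
    Filter.Tendsto (fun L : ℕ =>
      ((Literature.MathematicalPhysics.QuantumLattice.hubbardTorusWith 2 (L + 1) 1 U μ).groundStateFunctional
        Literature.MathematicalPhysics.QuantumLattice.totalNumber).re / ((L + 1 : ℕ) : ℝ) ^ 2)
      Filter.atTop (nhds (1 - δ)) →
    Filter.Tendsto (fun L : ℕ =>
      ((Literature.MathematicalPhysics.QuantumLattice.hubbardTorus 2 (L + 1) 1 U).minEnergyOn
          (Literature.MathematicalPhysics.QuantumLattice.szSector
            (2 * ⌊(1 - δ) * ((L + 1 : ℕ) : ℝ) ^ 2 / 2⌋₊) 0) -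
        μ * ((2 * ⌊(1 - δ) * ((L + 1 : ℕ) : ℝ) ^ 2 / 2⌋₊ : ℕ) : ℝ) -
        (Literature.MathematicalPhysics.QuantumLattice.hubbardTorusWith 2 (L + 1) 1 U μ).groundEnergy) /
        ((L + 1 : ℕ) : ℝ) ^ 2) Filter.atTop (nhds 0)

/-- **Stub D3c statement (regular `T = 0` equation of state across densities `[7/10, 9/10]` at weak
coupling).**  For all small `U > 0` the limiting grand-canonical ground-state energy density
`e(U,ν) = lim_L E₀(hubbardTorusWith 2 (L+1) 1 U ν)/(L+1)²` (the limit exists: `stub_torusGcEnergyDensityLimit`,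
Theorems/WeakCouplingBCSWcbcsBcsConstructionEnergyDensityLimit) is differentiable on some `μ`-window
`[μ₁, μ₂]` whose end densities bracket `[7/10, 9/10]`: `−∂e(U,μ₁) ≤ 7/10`, `9/10 ≤ −∂e(U,μ₂)` — no
first-order density jump (phase separation) of the weakly repulsive 2D Hubbard model across these
densities.  OPEN (the bracket inequalities alone follow from free level counts + `O(√U)` closeness; only
the differentiability is open; BenfattoGiulianiMastropietro2006 control `T ≥ e^{−a/U}` and low density
only); it is the `∀`-window strengthening of the registered open stub `stub_regularEquationOfState` of
crux stmt-HubbardSuperconductivity-2010 (`WcbcsBcsConstruction`).  With the tree's Griffiths apparatus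
(`HubbardGrandCanonicalDensity.exists_tendsto_gcDensity_of_regularWindow`) it yields, for every
`δ ∈ [1/10,3/10]`, a density-matched `μ` (verbatim the hypothesis of `SsbToEvenTorusLro`):
`densityMatched_of_regularEOS` below. Ruelle (1969) §3.4; Koma–Tasaki (1994) §1. [folklore] -/
def RegularEquationOfStateIcc : Prop :=
  ∃ U₂ : ℝ, 0 < U₂ ∧ ∀ U ∈ Set.Ioo (0 : ℝ) U₂, ∃ (e' : ℝ → ℝ) (μ₁ μ₂ : ℝ), μ₁ ≤ μ₂ ∧
    (∀ μ' ∈ Set.Icc μ₁ μ₂, HasDerivAt (fun ν : ℝ => limUnder Filter.atTop (fun L : ℕ =>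
      (Literature.MathematicalPhysics.QuantumLattice.hubbardTorusWith 2 (L + 1) 1 U ν).groundEnergy /
        ((L + 1 : ℕ) : ℝ) ^ 2)) (e' μ') μ') ∧
    -e' μ₁ ≤ 1 - 3 / 10 ∧ 1 - 1 / 10 ≤ -e' μ₂

/-- **Stub D3c' statement (lead c12 reshape of D3c to the form the composition consumes): a density-matched
chemical potential for every doping in the window, at weak coupling.**  For all small `U > 0` and every
`δ ∈ [1/10, 3/10]` there is `μ` at which the grand-canonical tracial ground-state density of
`hubbardTorusWith 2 (L+1) 1 U μ` tends to `1 − δ` — verbatim the hypothesis of `SsbToEvenTorusLro` (stmt-1315).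
Equivalently (Griffiths): no grand-canonical `T = 0` density JUMP interval of the weakly repulsive 2D Hubbard
model meets `[7/10, 9/10]` (phase separation); density PLATEAUS (kinks of the pressure) are allowed, which is
why this is strictly weaker than D3c (`RegularEquationOfStateIcc`, differentiability on a bracketing window
⇒ this, `densityMatched_of_regularEOS`).  OPEN (no source controls the `T = 0` equation of state at weak
coupling: BenfattoGiulianiMastropietro2006 reach `T ≥ e^{−a/U}` only); shared open input with cruxes
stmt-2010 / stmt-1315. Ruelle (1969) §3.4; Koma–Tasaki (1994) §1. [folklore] -/
def DensityMatchedWindow : Prop :=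
  ∃ U₂ : ℝ, 0 < U₂ ∧ ∀ U ∈ Set.Ioo (0 : ℝ) U₂, ∀ δ ∈ Set.Icc (1 / 10 : ℝ) (3 / 10), ∃ μ : ℝ,
    Filter.Tendsto (fun L : ℕ =>
      ((Literature.MathematicalPhysics.QuantumLattice.hubbardTorusWith 2 (L + 1) 1 U μ).groundStateFunctional
        Literature.MathematicalPhysics.QuantumLattice.totalNumber).re / ((L + 1 : ℕ) : ℝ) ^ 2)
      Filter.atTop (nhds (1 - δ))

/-! ## Registered stubs

The stub theorems carry their statements EXPANDED in tree vocabulary (no reference to the `def`s above,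
which live only in this workfile), so that a worker's landed `Theorems/…` theorem can repeat the
registered signature verbatim; the `example` after each stub certifies that the expanded text is the
corresponding `def`.  Stubs A and B are CLOSED by the landed theorems. -/

/-- **stub A — `NDSpeaksFrequently`** — CLOSED by
`Theorems.NodalDiracTwist.BridgeNodalToDWave.stub_ndSpeaksFrequently` (p141870). [folklore] -/
theorem stub_ndSpeaksFrequently : ∀ κ : ℝ, 0 < κ → κ < Real.pi → Real.cos κ ≠ 0 →
    ∃ ε : ℝ, 0 < ε ∧ ∀ L₀ : ℕ, ∃ L : ℕ, L₀ ≤ L ∧ Even L ∧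
      ∀ m : ℤ, ε ≤ |(L : ℝ) * κ - m * Real.pi| :=
  Summit.HubbardSuperconductivity.HubbardSuperconductivity.Theorems.NodalDiracTwist.BridgeNodalToDWave.stub_ndSpeaksFrequently

/-- **stub B — `UniqueGroundStateOfPackage`** — CLOSED by
`Theorems.NodalDiracTwist.BridgeNodalToDWave.stub_uniqueGroundStateOfPackage` (p141864). [folklore] -/
theorem stub_uniqueGroundStateOfPackage : ∀ (L : ℕ) [NeZero L], 3 ≤ L → ∀ (U : ℝ) (N : ℕ),
    (¬ ∃ ψ₁ ψ₂ : Literature.MathematicalPhysics.QuantumLattice.Fock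
        (Literature.MathematicalPhysics.QuantumLattice.Orb
          (Literature.MathematicalPhysics.QuantumLattice.FermionTorus 2 L)),
        Literature.MathematicalPhysics.QuantumLattice.IsGroundStateInSector
          (Literature.MathematicalPhysics.QuantumLattice.spinTwistedHubbardTorus L U 0) N 0 ψ₁ ∧
        Literature.MathematicalPhysics.QuantumLattice.IsGroundStateInSector
          (Literature.MathematicalPhysics.QuantumLattice.spinTwistedHubbardTorus L U 0) N 0 ψ₂ ∧
        star ψ₁ ⬝ᵥ ψ₂ = 0) →
    ∀ χ₁ χ₂ : Literature.MathematicalPhysics.QuantumLattice.Fock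
        (Literature.MathematicalPhysics.QuantumLattice.Orb
          (Literature.MathematicalPhysics.QuantumLattice.FermionTorus 2 L)),
      Literature.MathematicalPhysics.QuantumLattice.IsGroundStateInSector
        (Literature.MathematicalPhysics.QuantumLattice.hubbardTorus 2 L 1 U) N 0 χ₁ →
      Literature.MathematicalPhysics.QuantumLattice.IsGroundStateInSector
        (Literature.MathematicalPhysics.QuantumLattice.hubbardTorus 2 L 1 U) N 0 χ₂ →
      ∃ z : ℂ, χ₂ = z • χ₁ :=
  Summit.HubbardSuperconductivity.HubbardSuperconductivity.Theorems.NodalDiracTwist.BridgeNodalToDWave.stub_uniqueGroundStateOfPackage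

/-- **stub C — `ClassificationCore`** (the crux's physics; held by the lead).  Why it might fail: a
translation-invariant nodal liquid (Balents–Fisher–Nayak 1998) would satisfy the Dirac-quartet clause
with vanishing pair order; no classification theorem for gapless spectra exists at any coupling.
[cite: ArovasBergKivelsonRaghu2022, §5.1] -/
theorem stub_classificationCore : ∃ U₀ : ℝ, 0 < U₀ ∧ ∀ U ∈ Set.Ioo (0 : ℝ) U₀,
    ∀ δ ∈ Set.Icc (1 / 10 : ℝ) (3 / 10), ∃ c₀ : ℝ, 0 < c₀ ∧ ∃ L₁ : ℕ, ∀ (L : ℕ) [NeZero L],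
    Even L → L₁ ≤ L →
    (∃ c : ℝ, 0 < c ∧ c < Real.pi ∧
      (∀ φ : Fin 2 → ℝ, φ 0 ∈ Set.Ioc (-Real.pi) Real.pi → φ 1 ∈ Set.Ioc (-Real.pi) Real.pi →
        ((∃ ψ₁ ψ₂ : Literature.MathematicalPhysics.QuantumLattice.Fock
            (Literature.MathematicalPhysics.QuantumLattice.Orb
              (Literature.MathematicalPhysics.QuantumLattice.FermionTorus 2 L)),
          Literature.MathematicalPhysics.QuantumLattice.IsGroundStateInSector
            (Literature.MathematicalPhysics.QuantumLattice.spinTwistedHubbardTorus L U φ)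
            (2 * ⌊(1 - δ) * (L : ℝ) ^ 2 / 2⌋₊) 0 ψ₁ ∧
          Literature.MathematicalPhysics.QuantumLattice.IsGroundStateInSector
            (Literature.MathematicalPhysics.QuantumLattice.spinTwistedHubbardTorus L U φ)
            (2 * ⌊(1 - δ) * (L : ℝ) ^ 2 / 2⌋₊) 0 ψ₂ ∧
          star ψ₁ ⬝ᵥ ψ₂ = 0) ↔ (|φ 0| = c ∧ |φ 1| = c))) ∧
      (∀ p : Fin 2 → ℝ, |p 0| = c → |p 1| = c → ∀ r : ℝ, 0 < r → r < min c (Real.pi - c) →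
        ∃ n₀ : ℕ, ∀ n ≥ n₀, ∀ ψ : Fin n → Literature.MathematicalPhysics.QuantumLattice.Fock
            (Literature.MathematicalPhysics.QuantumLattice.Orb
              (Literature.MathematicalPhysics.QuantumLattice.FermionTorus 2 L)),
        (∀ i : Fin n, Literature.MathematicalPhysics.QuantumLattice.IsGroundStateInSector
            (Literature.MathematicalPhysics.QuantumLattice.spinTwistedHubbardTorus L U
              (fun ν : Fin 2 => p ν + r * (if ν = 0 then Real.cos (2 * Real.pi * (i : ℕ) / n)
                else Real.sin (2 * Real.pi * (i : ℕ) / n))))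
            (2 * ⌊(1 - δ) * (L : ℝ) ^ 2 / 2⌋₊) 0 (ψ i) ∧ star (ψ i) ⬝ᵥ ψ i = 1) →
        (∏ i : Fin n, star (ψ i) ⬝ᵥ ψ (finRotate n i)).re < 0)) →
    (∀ χ₁ χ₂ : Literature.MathematicalPhysics.QuantumLattice.Fock
        (Literature.MathematicalPhysics.QuantumLattice.Orb
          (Literature.MathematicalPhysics.QuantumLattice.FermionTorus 2 L)),
      Literature.MathematicalPhysics.QuantumLattice.IsGroundStateInSector
        (Literature.MathematicalPhysics.QuantumLattice.hubbardTorus 2 L 1 U)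
        (2 * ⌊(1 - δ) * (L : ℝ) ^ 2 / 2⌋₊) 0 χ₁ →
      Literature.MathematicalPhysics.QuantumLattice.IsGroundStateInSector
        (Literature.MathematicalPhysics.QuantumLattice.hubbardTorus 2 L 1 U)
        (2 * ⌊(1 - δ) * (L : ℝ) ^ 2 / 2⌋₊) 0 χ₂ →
      ∃ z : ℂ, χ₂ = z • χ₁) →
    ∀ χ : Literature.MathematicalPhysics.QuantumLattice.Fock
        (Literature.MathematicalPhysics.QuantumLattice.Orb
          (Literature.MathematicalPhysics.QuantumLattice.FermionTorus 2 L)),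
      Literature.MathematicalPhysics.QuantumLattice.IsGroundStateInSector
        (Literature.MathematicalPhysics.QuantumLattice.hubbardTorus 2 L 1 U)
        (2 * ⌊(1 - δ) * (L : ℝ) ^ 2 / 2⌋₊) 0 χ →
      star χ ⬝ᵥ χ = 1 →
      c₀ * (L : ℝ) ^ 4 ≤ (Literature.MathematicalPhysics.QuantumLattice.expect
        ((Literature.MathematicalPhysics.QuantumLattice.pairField
            Literature.MathematicalPhysics.QuantumLattice.dWaveFormFactor L)ᴴ *
          Literature.MathematicalPhysics.QuantumLattice.pairField
            Literature.MathematicalPhysics.QuantumLattice.dWaveFormFactor L) χ).re := by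
  sorry

example : ClassificationCore := stub_classificationCore

/-- **stub D1 — `SubsequenceOrderForcesSSB`** — CLOSED by
`Theorems.NodalDiracTwist.BridgeNodalToDWave.stub_subsequenceOrderForcesSSB` (p142988). [cite: KomaTasaki1994, Theorem 2.3] -/
theorem stub_subsequenceOrderForcesSSB : ∀ (U δ μ : ℝ), 0 < U → δ ∈ Set.Icc (1 / 10 : ℝ) (3 / 10) →
    (∀ h : ℝ, 0 ≤ h → ∃ e : ℝ, Filter.Tendsto (fun L : ℕ =>
      (Literature.MathematicalPhysics.QuantumLattice.dWaveSourceTorus (L + 1) U μ h).groundEnergy /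
        ((L + 1 : ℕ) : ℝ) ^ 2) Filter.atTop (nhds e)) →
    Filter.Tendsto (fun L : ℕ =>
      ((Literature.MathematicalPhysics.QuantumLattice.hubbardTorus 2 (L + 1) 1 U).minEnergyOn
          (Literature.MathematicalPhysics.QuantumLattice.szSector
            (2 * ⌊(1 - δ) * ((L + 1 : ℕ) : ℝ) ^ 2 / 2⌋₊) 0) -
        μ * ((2 * ⌊(1 - δ) * ((L + 1 : ℕ) : ℝ) ^ 2 / 2⌋₊ : ℕ) : ℝ) -
        (Literature.MathematicalPhysics.QuantumLattice.hubbardTorusWith 2 (L + 1) 1 U μ).groundEnergy) /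
        ((L + 1 : ℕ) : ℝ) ^ 2) Filter.atTop (nhds 0) →
    ∀ (N : ℕ → ℕ) (ψ : ∀ L, Literature.MathematicalPhysics.QuantumLattice.Fock
    (Literature.MathematicalPhysics.QuantumLattice.Orb
    (Literature.MathematicalPhysics.QuantumLattice.FermionTorus 2 L))), (∀ L, Even L → N L = 2 * ⌊(1
    - δ) * (L : ℝ) ^ 2 / 2⌋₊ ∧ star (ψ L) ⬝ᵥ ψ L = 1 ∧
    Literature.MathematicalPhysics.QuantumLattice.IsGroundStateInSector
    (Literature.MathematicalPhysics.QuantumLattice.hubbardTorus 2 L 1 U) (N L) 0 (ψ L)) →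
    (∃ c : ℝ, 0 < c ∧ ∃ᶠ k : ℕ in Filter.atTop, c ≤ (∑ x ∈
    Literature.Probability.LatticeModels.halfOpenBox 2 (2 * k), ∑ y ∈
    Literature.Probability.LatticeModels.halfOpenBox 2 (2 * k),
    Literature.MathematicalPhysics.QuantumLattice.torusPullback
    (Literature.MathematicalPhysics.QuantumLattice.pairFieldCorr
    Literature.MathematicalPhysics.QuantumLattice.dWaveFormFactor ψ) (2 * k) x y) /
    ((Literature.Probability.LatticeModels.halfOpenBox 2 (2 * k)).card : ℝ) ^ 2) →
    Literature.MathematicalPhysics.QuantumLattice.HasDWaveOrder U μ :=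
  Summit.HubbardSuperconductivity.HubbardSuperconductivity.Theorems.NodalDiracTwist.BridgeNodalToDWave.stub_subsequenceOrderForcesSSB

example : SubsequenceOrderForcesSSB := stub_subsequenceOrderForcesSSB

/-- **stub D3a — `SourcedEnergyDensityLimit`** — CLOSED by
`Theorems.NodalDiracTwist.BridgeNodalToDWave.stub_sourcedEnergyDensityLimit` (p143420; zero-temperature sandwich of the
sourced pressure limit). [cite: Ruelle1969, §3.3] -/
theorem stub_sourcedEnergyDensityLimit : ∀ (U μ h : ℝ), 0 ≤ U → 0 ≤ h → ∃ e : ℝ, Filter.Tendsto (fun L : ℕ =>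
      (Literature.MathematicalPhysics.QuantumLattice.dWaveSourceTorus (L + 1) U μ h).groundEnergy /
        ((L + 1 : ℕ) : ℝ) ^ 2) Filter.atTop (nhds e) :=
  Summit.HubbardSuperconductivity.HubbardSuperconductivity.Theorems.NodalDiracTwist.BridgeNodalToDWave.stub_sourcedEnergyDensityLimit

example : SourcedEnergyDensityLimit := stub_sourcedEnergyDensityLimit

/-- **stub D3b — `EnergyMatchingOfDensityMatching`** — CLOSED by
`Theorems.NodalDiracTwist.BridgeNodalToDWave.stub_energyMatchingOfDensityMatching` (p143074). [folklore] -/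
theorem stub_energyMatchingOfDensityMatching : ∀ (U δ μ : ℝ), 0 < U → δ ∈ Set.Icc (1 / 10 : ℝ) (3 / 10) →
    Filter.Tendsto (fun L : ℕ =>
      ((Literature.MathematicalPhysics.QuantumLattice.hubbardTorusWith 2 (L + 1) 1 U μ).groundStateFunctional
        Literature.MathematicalPhysics.QuantumLattice.totalNumber).re / ((L + 1 : ℕ) : ℝ) ^ 2)
      Filter.atTop (nhds (1 - δ)) →
    Filter.Tendsto (fun L : ℕ =>
      ((Literature.MathematicalPhysics.QuantumLattice.hubbardTorus 2 (L + 1) 1 U).minEnergyOn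
          (Literature.MathematicalPhysics.QuantumLattice.szSector
            (2 * ⌊(1 - δ) * ((L + 1 : ℕ) : ℝ) ^ 2 / 2⌋₊) 0) -
        μ * ((2 * ⌊(1 - δ) * ((L + 1 : ℕ) : ℝ) ^ 2 / 2⌋₊ : ℕ) : ℝ) -
        (Literature.MathematicalPhysics.QuantumLattice.hubbardTorusWith 2 (L + 1) 1 U μ).groundEnergy) /
        ((L + 1 : ℕ) : ℝ) ^ 2) Filter.atTop (nhds 0) :=
  Summit.HubbardSuperconductivity.HubbardSuperconductivity.Theorems.NodalDiracTwist.BridgeNodalToDWave.stub_energyMatchingOfDensityMatching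

example : EnergyMatchingOfDensityMatching := stub_energyMatchingOfDensityMatching

/-- **stub D3c' — `DensityMatchedWindow`** (OPEN; lead c12 reshape of D3c to the consumed form: a
density-matched `μ` for every `δ ∈ [1/10,3/10]` at weak coupling = no grand-canonical density jump across
`[7/10, 9/10]`; implied by the former D3c via `densityMatched_of_regularEOS`). [folklore] -/
theorem stub_densityMatchedWindow : ∃ U₂ : ℝ, 0 < U₂ ∧ ∀ U ∈ Set.Ioo (0 : ℝ) U₂, ∀ δ ∈ Set.Icc (1 / 10 : ℝ) (3 / 10), ∃ μ : ℝ, Filter.Tendsto (fun L : ℕ => ((Literature.MathematicalPhysics.QuantumLattice.hubbardTorusWith 2 (L + 1) 1 U μ).groundStateFunctional Literature.MathematicalPhysics.QuantumLattice.totalNumber).re / ((L + 1 : ℕ) : ℝ) ^ 2) Filter.atTop (nhds (1 - δ)) := by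
  sorry

example : DensityMatchedWindow := stub_densityMatchedWindow

/-! ## Name-keyed aliases of the stub statements — the hypotheses of the composition theorems -/
namespace __Registered

/-- Alias of `NDSpeaksFrequently` keyed by the registered stub name. -/
abbrev stub_ndSpeaksFrequently : Prop := ∀ κ : ℝ, 0 < κ → κ < Real.pi → Real.cos κ ≠ 0 →
    ∃ ε : ℝ, 0 < ε ∧ ∀ L₀ : ℕ, ∃ L : ℕ, L₀ ≤ L ∧ Even L ∧ ∀ m : ℤ, ε ≤ |(L : ℝ) * κ - m * Real.pi|
/-- Alias of `UniqueGroundStateOfPackage` keyed by the registered stub name. -/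
abbrev stub_uniqueGroundStateOfPackage : Prop := ∀ (L : ℕ) [NeZero L], 3 ≤ L → ∀ (U : ℝ) (N : ℕ),
    (¬ ∃ ψ₁ ψ₂ : Fock (Orb (FermionTorus 2 L)),
        IsGroundStateInSector (spinTwistedHubbardTorus L U 0) N 0 ψ₁ ∧
        IsGroundStateInSector (spinTwistedHubbardTorus L U 0) N 0 ψ₂ ∧ star ψ₁ ⬝ᵥ ψ₂ = 0) →
    ∀ χ₁ χ₂ : Fock (Orb (FermionTorus 2 L)),
      IsGroundStateInSector (hubbardTorus 2 L 1 U) N 0 χ₁ →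
      IsGroundStateInSector (hubbardTorus 2 L 1 U) N 0 χ₂ → ∃ z : ℂ, χ₂ = z • χ₁
/-- Alias of `ClassificationCore` keyed by the registered stub name. -/
abbrev stub_classificationCore : Prop := ClassificationCore
/-- Alias of `SubsequenceOrderForcesSSB` keyed by the registered stub name. -/
abbrev stub_subsequenceOrderForcesSSB : Prop := SubsequenceOrderForcesSSB
/-- Alias of `SourcedEnergyDensityLimit` keyed by the registered stub name. -/
abbrev stub_sourcedEnergyDensityLimit : Prop := SourcedEnergyDensityLimit
/-- Alias of `EnergyMatchingOfDensityMatching` keyed by the registered stub name. -/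
abbrev stub_energyMatchingOfDensityMatching : Prop := EnergyMatchingOfDensityMatching
/-- Alias of `RegularEquationOfStateIcc` (former stub D3c, no longer registered; sufficient for D3c'). -/
abbrev stub_regularEquationOfStateIcc : Prop := RegularEquationOfStateIcc
/-- Alias of `DensityMatchedWindow` keyed by the registered stub name (D3c'). -/
abbrev stub_densityMatchedWindow : Prop := DensityMatchedWindow

end __Registered

/-! ## Structural sub-goals (lead c12, all CLOSED: p156485, p156700, p156972): the diagonal parity flip and its global form

`stub_diagonalParityFlip` — at a diagonal twist `p` (`p₀ = p₁`) carrying the holonomy clause (II) of the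
package for the radius `r`, unique sector ground states at the two DIAGONAL vertices of the circle are
eigenvectors of the swap `U_{sr 3}` (`(x₀,x₁) ↦ (x₁,x₀)`) with OPPOSITE signs: the `x ↔ y` parity of the
ground state flips across every diagonal Dirac point (proved in work/DiagonalParityFlip.lean →
Theorems/NodalDiracTwistBridgeNodalToDWaveDiagonalParityFlip.lean, no continuity hypothesis). -/

/-- **Registered sub-goal (lead c12), CLOSED by `Theorems…DiagonalParityFlipLoop.stub_swapTransport` (p156485): the swap transports sector ground states across the diagonal**
(`U_{sr 3}`: `H_L(U,(φ₀,φ₁)) ↝ H_L(U,(φ₁,φ₀))`; ingredient of the parity flip). Scalapino (1995) §2. [folklore] -/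
theorem stub_swapTransport : ∀ (L : ℕ) [NeZero L] (U : ℝ) (φ : Fin 2 → ℝ) (N : ℕ) (M : ℝ) (χ : Literature.MathematicalPhysics.QuantumLattice.Fock (Literature.MathematicalPhysics.QuantumLattice.Orb (Literature.MathematicalPhysics.QuantumLattice.FermionTorus 2 L))), Literature.MathematicalPhysics.QuantumLattice.IsGroundStateInSector (Literature.MathematicalPhysics.QuantumLattice.spinTwistedHubbardTorus L U φ) N M χ → Literature.MathematicalPhysics.QuantumLattice.IsGroundStateInSector (Literature.MathematicalPhysics.QuantumLattice.spinTwistedHubbardTorus L U ![φ 1, φ 0]) N M (Matrix.mulVec (Literature.MathematicalPhysics.QuantumLattice.fockD4 (L := L) (DihedralGroup.sr 3)).val χ) :=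
  Summit.HubbardSuperconductivity.HubbardSuperconductivity.Theorems.NodalDiracTwist.BridgeNodalToDWave.stub_swapTransport

/-- **Registered sub-goal (lead c12), CLOSED by `Theorems…DiagonalParityFlip.stub_diagonalParityFlip` (p156700): the diagonal parity flip** — see the section doc.
Hatsugai (2006); Longuet-Higgins (1975). [folklore] -/
theorem stub_diagonalParityFlip : ∀ (L : ℕ) [NeZero L] (U : ℝ) (N : ℕ) (p : Fin 2 → ℝ), p 0 = p 1 → ∀ (r : ℝ), (∃ n₀ : ℕ, ∀ n ≥ n₀, ∀ ψ : Fin n → Literature.MathematicalPhysics.QuantumLattice.Fock (Literature.MathematicalPhysics.QuantumLattice.Orb (Literature.MathematicalPhysics.QuantumLattice.FermionTorus 2 L)), (∀ i : Fin n, Literature.MathematicalPhysics.QuantumLattice.IsGroundStateInSector (Literature.MathematicalPhysics.QuantumLattice.spinTwistedHubbardTorus L U (fun ν : Fin 2 => p ν + r * (if ν = 0 then Real.cos (2 * Real.pi * (i : ℕ) / n) else Real.sin (2 * Real.pi * (i : ℕ) / n)))) N 0 (ψ i) ∧ star (ψ i) ⬝ᵥ ψ i = 1) → (∏ i : Fin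 n, star (ψ i) ⬝ᵥ ψ (finRotate n i)).re < 0) → ∀ (χp χm : Literature.MathematicalPhysics.QuantumLattice.Fock (Literature.MathematicalPhysics.QuantumLattice.Orb (Literature.MathematicalPhysics.QuantumLattice.FermionTorus 2 L))), Literature.MathematicalPhysics.QuantumLattice.IsGroundStateInSector (Literature.MathematicalPhysics.QuantumLattice.spinTwistedHubbardTorus L U (fun ν : Fin 2 => p ν + r * (if ν = 0 then Real.cos (Real.pi / 4) else Real.sin (Real.pi / 4)))) N 0 χp → (∀ χ' : Literature.MathematicalPhysics.QuantumLattice.Fock (Literature.MathematicalPhysics.QuantumLattice.Orb (Literature.MathematicalPhysics.QuantumLattice.FermionTorus 2 L)), Literature.MathematicalPhysics.QuantumLattice.IsGroundStateInSector (Literature.MathematicalPhysics.QuantumLattice.spinTwistedHubbardTorus L U (fun ν : Fin 2 => p ν + r * (if ν = 0 then Real.cos (Real.pi / 4) else Real.sin (Real.pi / 4)))) N 0 χ' → ∃ z : ℂ, χ' = z • χp) → Literature.MathematicalPhysics.QuantumLattice.IsGroundStateInSector (Literature.MathematicalPhysics.QuantumLattice.spinTwistedHubbardTorus L U (fun ν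 : Fin 2 => p ν + r * (if ν = 0 then Real.cos (5 * Real.pi / 4) else Real.sin (5 * Real.pi / 4)))) N 0 χm → (∀ χ' : Literature.MathematicalPhysics.QuantumLattice.Fock (Literature.MathematicalPhysics.QuantumLattice.Orb (Literature.MathematicalPhysics.QuantumLattice.FermionTorus 2 L)), Literature.MathematicalPhysics.QuantumLattice.IsGroundStateInSector (Literature.MathematicalPhysics.QuantumLattice.spinTwistedHubbardTorus L U (fun ν : Fin 2 => p ν + r * (if ν = 0 then Real.cos (5 * Real.pi / 4) else Real.sin (5 * Real.pi / 4)))) N 0 χ' → ∃ z : ℂ, χ' = z • χm) → (Matrix.mulVec (Literature.MathematicalPhysics.QuantumLattice.fockD4 (L := L) (DihedralGroup.sr 3)).val χp = χp ∧ Matrix.mulVec (Literature.MathematicalPhysics.QuantumLattice.fockD4 (L := L) (DihedralGroup.sr 3)).val χm = -χm) ∨ (Matrix.mulVec (Literature.MathematicalPhysics.QuantumLattice.fockD4 (L := L) (DihedralGroup.sr 3)).val χp = -χp ∧ Matrix.mulVec (Literature.MathematicalPhysics.QuantumLattice.fockD4 (L := L) (DihedralGroup.sr 3)).val χm = χm)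 :=
  Summit.HubbardSuperconductivity.HubbardSuperconductivity.Theorems.NodalDiracTwist.BridgeNodalToDWave.stub_diagonalParityFlip

/-- **Registered sub-goal (lead c12), CLOSED by `Theorems…DiagonalParitySegment.stub_swapParityZeroVsPi` (p156972): GLOBAL form of the parity flip** — under clause (I) on the cell and
clause (II) at `(c, c)` for one radius `r < min(c, π − c)`, the swap parity of every `(N,0)` sector GS of
`hubbardTorus 2 L 1 U` (`L ≥ 3`) is opposite to that of every sector GS of `H_L(U,(π,π))` (constancy of the
sign along the diagonal segments of uniqueness + the flip across `(c,c)`; work/DiagonalParitySegment.lean →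
Theorems/NodalDiracTwistBridgeNodalToDWaveDiagonalParitySegment.lean). Hatsugai (2006); Kato (1966) II §5.1. [folklore] -/
theorem stub_swapParityZeroVsPi : ∀ (L : ℕ) [NeZero L], 3 ≤ L → ∀ (U : ℝ) (N : ℕ) (c : ℝ), (∀ φ : Fin 2 → ℝ, φ 0 ∈ Set.Ioc (-Real.pi) Real.pi → φ 1 ∈ Set.Ioc (-Real.pi) Real.pi → ((∃ ψ₁ ψ₂ : Literature.MathematicalPhysics.QuantumLattice.Fock (Literature.MathematicalPhysics.QuantumLattice.Orb (Literature.MathematicalPhysics.QuantumLattice.FermionTorus 2 L)), Literature.MathematicalPhysics.QuantumLattice.IsGroundStateInSector (Literature.MathematicalPhysics.QuantumLattice.spinTwistedHubbardTorus L U φ) N 0 ψ₁ ∧ Literature.MathematicalPhysics.QuantumLattice.IsGroundStateInSector (Literature.MathematicalPhysics.QuantumLattice.spinTwistedHubbardTorus L U φ) N 0 ψ₂ ∧ star ψ₁ ⬝ᵥ ψ₂ = 0) ↔ (|φ 0| = c ∧ |φ 1| = c))) → ∀ (p : Fin 2 → ℝ), p 0 = c → p 1 = c → ∀ (r : ℝ),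 0 < r → r < min c (Real.pi - c) → (∃ n₀ : ℕ, ∀ n ≥ n₀, ∀ ψ : Fin n → Literature.MathematicalPhysics.QuantumLattice.Fock (Literature.MathematicalPhysics.QuantumLattice.Orb (Literature.MathematicalPhysics.QuantumLattice.FermionTorus 2 L)), (∀ i : Fin n, Literature.MathematicalPhysics.QuantumLattice.IsGroundStateInSector (Literature.MathematicalPhysics.QuantumLattice.spinTwistedHubbardTorus L U (fun ν : Fin 2 => p ν + r * (if ν = 0 then Real.cos (2 * Real.pi * (i : ℕ) / n) else Real.sin (2 * Real.pi * (i : ℕ) / n)))) N 0 (ψ i) ∧ star (ψ i) ⬝ᵥ ψ i = 1) → (∏ i : Fin n, star (ψ i) ⬝ᵥ ψ (finRotate n i)).re < 0) → ∀ (χ₀ χπ : Literature.MathematicalPhysics.QuantumLattice.Fock (Literature.MathematicalPhysics.QuantumLattice.Orb (Literature.MathematicalPhysics.QuantumLattice.FermionTorus 2 L))), Literature.MathematicalPhysics.QuantumLattice.IsGroundStateInSector (Literature.MathematicalPhysics.QuantumLattice.hubbardTorus 2 L 1 U) N 0 χ₀ → Literature.MathematicalPhysics.QuantumLattice.IsGroundStateInSector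 (Literature.MathematicalPhysics.QuantumLattice.spinTwistedHubbardTorus L U (fun _ : Fin 2 => Real.pi)) N 0 χπ → (Matrix.mulVec (Literature.MathematicalPhysics.QuantumLattice.fockD4 (L := L) (DihedralGroup.sr 3)).val χ₀ = χ₀ ∧ Matrix.mulVec (Literature.MathematicalPhysics.QuantumLattice.fockD4 (L := L) (DihedralGroup.sr 3)).val χπ = -χπ) ∨ (Matrix.mulVec (Literature.MathematicalPhysics.QuantumLattice.fockD4 (L := L) (DihedralGroup.sr 3)).val χ₀ = -χ₀ ∧ Matrix.mulVec (Literature.MathematicalPhysics.QuantumLattice.fockD4 (L := L) (DihedralGroup.sr 3)).val χπ = χπ) :=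
  Summit.HubbardSuperconductivity.HubbardSuperconductivity.Theorems.NodalDiracTwist.BridgeNodalToDWave.stub_swapParityZeroVsPi

/-! ## Structural sub-goals (CLOSED, lead c11) — rigorous consequences of the package for C's objects

All landed `--supports stmt-HubbardSuperconductivity-10395` (registered sub-goals in parentheses):
* p150357 `…RealMomentum` (`stub_uniqueGroundStateSymmetrySign`): `H_L(U,φ)` is translation invariant at
  every twist; a unique `(N,S^z=0)` sector GS of `H_L(U,φ)` is a `±1` eigenvector of `U_g` for every site
  symmetry `g` (antiunitary `T = F∘K` ⇒ real characters): real crystal momentum, real `D₄` character.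
* p150906 `…RealMomentumDiagonal` (`stub_untwistedMomentumZeroOrPiPi`): the unique untwisted sector GS has
  momentum `(0,0)` or `(π,π)`.
* p151426 `…MomentumLocallyConstant` (`stub_momentumLocallyConstant`): on a disk of uniqueness the momentum
  of the GS does not depend on the twist (`uniform_overlap` + unitarity).
* p152142 `…MomentumTube` (`stub_signEqOfTube`), p152408 `…MomentumGlobal` (`stub_clauseIMomentumConstant`):
  under clause (I) the momentum is the same at every twist of the open cell off the quartet as at `φ = 0`.
* p152732 `…DiracBlockLimit` (`stub_groundStateAtLimit`), `…DiracIntraBlock` (`stub_orthogonalPairInBlock`),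
  `…DiracIntraBlockMomentum` (`stub_diracPairInMomentumBlock`): clauses (I)+(II) force, at every Dirac
  point `(±c,±c)`, an ORTHOGONAL PAIR of sector ground states inside the momentum block of the bulk GS —
  the holonomy-`−1` crossings are intra-block conical crossings, not contacts with a foreign momentum
  sector (abstract trivial-holonomy theorem applied to the sub-sector `K ⊓ V`).
The two `example`s below re-check the first and last links against the tree. -/

example : ∀ (L : ℕ) [NeZero L], 3 ≤ L → ∀ (U : ℝ) (N : ℕ) (χ : Fock (Orb (FermionTorus 2 L))),
    IsGroundStateInSector (hubbardTorus 2 L 1 U) N 0 χ →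
    (∀ χ', IsGroundStateInSector (hubbardTorus 2 L 1 U) N 0 χ' → ∃ z : ℂ, χ' = z • χ) →
    ((fockTranslate (Pi.single 0 1 : TorusSite 2 L)).val *ᵥ χ = χ ∧
        (fockTranslate (Pi.single 1 1 : TorusSite 2 L)).val *ᵥ χ = χ) ∨
      ((fockTranslate (Pi.single 0 1 : TorusSite 2 L)).val *ᵥ χ = -χ ∧
        (fockTranslate (Pi.single 1 1 : TorusSite 2 L)).val *ᵥ χ = -χ) :=
  fun _ _ hL _ _ _ hχ huniq =>
    Summit.HubbardSuperconductivity.HubbardSuperconductivity.Theorems.NodalDiracTwist.BridgeNodalToDWave.hubbardTorus_momentum_zero_or_pi_pi hL hχ huniq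

example := @Summit.HubbardSuperconductivity.HubbardSuperconductivity.Theorems.NodalDiracTwist.BridgeNodalToDWave.dirac_pair_in_momentum_block

/-! ## Sorry-free glue -/

/-- One term of the Statement's LRO sequence at side `L + 1` is the normalised pair-field
expectation: `|Λ_{L+1}|⁻² Σ_{x,y ∈ Λ_{L+1}} G_{L+1}(x,y) = re ⟨ψ_{L+1}, Δ_g† Δ_g ψ_{L+1}⟩ / (L+1)⁴`
(`sum_torusPullback_succ`, `sum_pairFieldCorr_succ`). Scalapino, Phys. Rep. 250 (1995) 329, §2 eq. (2.4). [folklore] -/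
theorem lroSeq_succ_eq_expect (g : Literature.Probability.LatticeModels.Site 2 → ℝ)
    (ψ : ∀ L, Fock (Orb (FermionTorus 2 L))) (L : ℕ) :
    (∑ x ∈ halfOpenBox 2 (L + 1), ∑ y ∈ halfOpenBox 2 (L + 1),
        torusPullback (pairFieldCorr g ψ) (L + 1) x y) / ((halfOpenBox 2 (L + 1)).card : ℝ) ^ 2 =
      (expect ((pairField g (L + 1))ᴴ * pairField g (L + 1)) (ψ (L + 1))).re /
        ((L + 1 : ℕ) : ℝ) ^ 4 := by
  rw [sum_torusPullback_succ, sum_pairFieldCorr_succ]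

/-- **Regular equation of state ⇒ a density-matched chemical potential for every doping in the window**
(Darboux + Griffiths: `exists_tendsto_gcDensity_of_regularWindow`, with the grand-canonical thermodynamic
limit `stub_torusGcEnergyDensityLimit`).  Worker reduction of wave 2 (stub-worker D3c), moved into the
skeleton. Ruelle (1969) §3.4; Koma–Tasaki (1994) §1. [folklore] -/
theorem densityMatched_of_regularEOS (hreg : RegularEquationOfStateIcc) :
    ∃ U₂ : ℝ, 0 < U₂ ∧ ∀ U ∈ Set.Ioo (0 : ℝ) U₂, ∀ δ ∈ Set.Icc (1 / 10 : ℝ) (3 / 10), ∃ μ : ℝ,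
    Filter.Tendsto (fun L : ℕ => ((hubbardTorusWith 2 (L + 1) 1 U μ).groundStateFunctional
      totalNumber).re / ((L + 1 : ℕ) : ℝ) ^ 2) Filter.atTop (nhds (1 - δ)) := by
  obtain ⟨U₂, hU₂, hwin⟩ := hreg
  refine ⟨U₂, hU₂, fun U hU δ hδ => ?_⟩
  obtain ⟨e', μ₁, μ₂, h12, hder, h₁, h₂⟩ := hwin U hU
  have hlim : ∀ μ' : ℝ, Tendsto (fun L : ℕ => (hubbardTorusWith 2 (L + 1) 1 U μ').groundEnergy /
      ((L + 1 : ℕ) : ℝ) ^ 2) atTop (nhds ((fun ν : ℝ => limUnder atTop (fun L : ℕ =>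
        (hubbardTorusWith 2 (L + 1) 1 U ν).groundEnergy / ((L + 1 : ℕ) : ℝ) ^ 2)) μ')) := fun μ' =>
    tendsto_nhds_limUnder
      (Summit.HubbardSuperconductivity.HubbardSuperconductivity.Theorems.stub_torusGcEnergyDensityLimit U μ')
  obtain ⟨μ, -, hμ⟩ := exists_tendsto_gcDensity_of_regularWindow 1 U h12 hlim hder h₁ h₂ hδ
  exact ⟨μ, hμ⟩

/-- **D3c ⇒ D3c'**: the former registered stub (EOS differentiability on a bracketing window) implies the
reshaped one (a density-matched `μ` for every doping in the window). [folklore] -/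
theorem densityMatchedWindow_of_regularEOS (hreg : __Registered.stub_regularEquationOfStateIcc) :
    __Registered.stub_densityMatchedWindow :=
  densityMatched_of_regularEOS hreg

/-! ## Composition 1: birth stub 1 from A + B + C (no `sorry`) -/

/-- **`nodalOrderAlongSubsequence_of_core`** — `ND` speaks on infinitely many even sides (A); where it
speaks, `φ = 0` is off the four-point locus (`c > 0`), so the untwisted sector ground state is unique
(B); the per-volume classification (C) then gives `c₀ L⁴ ≤ re⟨ψ_L, Δ_d†Δ_d ψ_L⟩` at every such large even
side `L = 2k`, i.e. `c₀ ≤ F_ψ(k)` frequently. [folklore] -/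
theorem nodalOrderAlongSubsequence_of_core
    (hC : __Registered.stub_classificationCore) : NodalOrderAlongSubsequence :=
  -- landed by lead c10 (p147723): A + B + C, with A = `stub_ndSpeaksFrequently` (p141870) and
  -- B = `stub_uniqueGroundStateOfPackage` (p141864) entering as tree theorems
  Summit.HubbardSuperconductivity.HubbardSuperconductivity.Theorems.NodalDiracTwist.BridgeNodalToDWave.nodalOrderAlongSubsequence_of_classificationCore hC

/-! ## Composition 2: the crux BY NAME (no `sorry`; stmt-1315 enters as the named hypothesis `h1315`) -/

/-- **`BridgeNodalToDWave_of`** — A, B, C give frequent `d`-wave order of the given admissible family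
(`nodalOrderAlongSubsequence_of_core`); D3c (regular equation of state, via `densityMatched_of_regularEOS`)
supplies a density-matched chemical potential `μ` (DM),
D3b turns it into energy matching (EM), D3a gives the sourced thermodynamic limit (TL), D1 turns
frequent order into Koma–Tasaki order `HasDWaveOrder U μ`, and the transfer crux `SsbToEvenTorusLro`
(stmt-HubbardSuperconductivity-1315, hypothesis `h1315`) returns the Statement's LRO for every
admissible family — in particular the given one. [folklore] -/
theorem BridgeNodalToDWave_of (hC : __Registered.stub_classificationCore)
    (hDMW : __Registered.stub_densityMatchedWindow)
    (h1315 : Summit.HubbardSuperconductivity.HubbardSuperconductivity.Theses.AposterioriCapRg.SsbToEvenTorusLro) :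
    Summit.HubbardSuperconductivity.HubbardSuperconductivity.Theses.NodalDiracTwist.BridgeNodalToDWave := by
  -- lead c12 (skeleton v10): the proof of the landed p147723 `bridgeNodalToDWave_of_classificationCore` with the
  -- density-matched `μ` taken from D3c' directly instead of from D3c via `densityMatched_of_regularEOS`;
  -- D1 (p142988), D3a (p143420), D3b (p143074) enter as tree theorems.
  have hD1 := Summit.HubbardSuperconductivity.HubbardSuperconductivity.Theorems.NodalDiracTwist.BridgeNodalToDWave.stub_subsequenceOrderForcesSSB
  have hD3a := Summit.HubbardSuperconductivity.HubbardSuperconductivity.Theorems.NodalDiracTwist.BridgeNodalToDWave.stub_sourcedEnergyDensityLimit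
  have hD3b := Summit.HubbardSuperconductivity.HubbardSuperconductivity.Theorems.NodalDiracTwist.BridgeNodalToDWave.stub_energyMatchingOfDensityMatching
  obtain ⟨U₀, hU₀, h1⟩ := nodalOrderAlongSubsequence_of_core hC
  obtain ⟨U₂, hU₂, h3⟩ := hDMW
  refine ⟨min U₀ U₂, lt_min hU₀ hU₂, ?_⟩
  intro U hU δ hδ hND N ψ hyp
  have hU0 : U ∈ Set.Ioo (0 : ℝ) U₀ := ⟨hU.1, lt_of_lt_of_le hU.2 (min_le_left _ _)⟩
  have hU2 : U ∈ Set.Ioo (0 : ℝ) U₂ := ⟨hU.1, lt_of_lt_of_le hU.2 (min_le_right _ _)⟩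
  obtain ⟨c, hc, hfreq⟩ := h1 U hU0 δ hδ hND N ψ hyp
  obtain ⟨μ, hDM⟩ := h3 U hU2 δ hδ
  have hEM := hD3b U δ μ hU.1 hδ hDM
  have hTL := fun h (hh : (0 : ℝ) ≤ h) => hD3a U μ h hU.1.le hh
  have hOrder : HasDWaveOrder U μ := hD1 U δ μ hU.1 hδ hTL hEM N ψ hyp ⟨c, hc, hfreq⟩
  have hδ' : δ ∈ Set.Ioo (0 : ℝ) 1 := ⟨by linarith [hδ.1], by linarith [hδ.2]⟩
  exact h1315 U δ μ hU.1 hδ' hDM hOrder N ψ hyp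

/-- The former composition through D3c (= tree p147723) remains available: D3c ⇒ D3c' ⇒ crux. [folklore] -/
theorem BridgeNodalToDWave_of_regularEOS (hC : __Registered.stub_classificationCore)
    (hD3c : __Registered.stub_regularEquationOfStateIcc)
    (h1315 : Summit.HubbardSuperconductivity.HubbardSuperconductivity.Theses.AposterioriCapRg.SsbToEvenTorusLro) :
    Summit.HubbardSuperconductivity.HubbardSuperconductivity.Theses.NodalDiracTwist.BridgeNodalToDWave :=
  Summit.HubbardSuperconductivity.HubbardSuperconductivity.Theorems.NodalDiracTwist.BridgeNodalToDWave.bridgeNodalToDWave_of_classificationCore hC hD3c h1315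

end Summit.HubbardSuperconductivity.HubbardSuperconductivity.Cruxes.BridgeNodalToDWave.Birth

end
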